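import Literature.MathematicalPhysics.QuantumFieldTheory.Balaban1983to89.B8Thm4SupportLocalBdryG

/-!
# `Balaban1983to89.B8Thm4SupportLocalBdryGR129` — [Balaban1985RegularSpaces] THEOREM 4 (p. 88): THE LEVEL INDUCTION (support invariant + `G`-valued gauge
# transformations, = ✓`B8Thm4SupportLocalBdryG` §1) WITH THE RESTRICTION (1.29) AS AN **ABSTRACT LETTER** `R m u`

statement-level skeleton of published theorems with citation tags; proofs where landed; nothing here is a claim about the Yang–Mills mass gap

T. Bałaban, *Spaces of regular gauge field configurations on a lattice and gauge fixing conditions*, Commun. Math. Phys. **99** (1985) 75–102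
`[Balaban1985RegularSpaces]` ("B8"; journal page = PDF page + 74): Thm 4 p. 88, proof pp. 88–89 («by induction with respect to k») and pp. 94–95 ((1.107)–(1.111)),
Prop. 5 p. 94, Prop. 3 p. 87, (1.17) p. 78, (1.29) p. 81, p. 76 («G = SU(N)»); T. Bałaban, *Renormalization group approach to lattice gauge field theories. I*,
Commun. Math. Phys. **109** (1987) 249–301 `[Balaban1987RG1]`, (0.4) p. 253 and p. 253–254 («The proofs are in most cases unchanged …»).  STATUS: published, refereed.

CITATION HEADER (lean-in-tree rule).  Cell `pub-ymgap`, base `pub-ymgap-dag-n05-c` g26 (REACTIVATED for ONE item, director-ym №255 (B) 2026-08-29: «N05-REC R5 —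
Thm-4 driver ∕ Prop 5 ∕ Sect. E re-key for the RECORD's symmetrised centred (0.4) averaging structure», LEAD PEN dag-n05-e g35).  WHY THIS FILE: the kernel-side
dependency census of the R5 layer (`pub-ymgap-dag-n05-c/R5-CENSUS.md` a6ce38428fac8451) shows that Theorem 4's level induction — print's «u = u′u₁» bookkeeping,
pp. 88–89 ∕ 94–95 — reaches the block-averaging structure through EXACTLY ONE letter, the restriction (1.29) «(R̄₀uʲ)(y) = 1 for y ∈ Λ_j, j ≤ k»
(`B8Eq119TwistedAxial.Restr129`, built on [3]'s corner-anchored tree-word transporters), and uses of it EXACTLY ONE property, `R̄₀(1) = 1` (`B8Thm4TruncationLocal.restr129_one`):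
the Proposition-5 sockets DELIVER (1.29) for `u₁·v`, the Proposition-3 socket READS it, the induction PASSES IT THROUGH.  So the induction is typed here ONCE with (1.29) as an
abstract letter `R : ℕ → (Site d → 𝔸ˣ) → Prop` (`R m u` = «u satisfies the level-m restriction»), hypothesis `R 0 1`; every averaging structure — [3]∕[6]'s corner tree words
(`R m u := Restr129 L m (Λs m) U₀ u`, §2: the landed G-edition §1 re-derived by ONE `exact`) or [Balaban1987RG1] (0.4)'s symmetrised centred blocks (the record twin
`Restr129Rec` of the N05-REC road, R0b) — instantiates it by one `exact`.  WHAT IS REPRODUCED = ✓`B8Thm4SupportLocalBdryG.thm4_exists_all_levels_supp_bdry_mem` VERBATIM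
(its proof line by line; the step through ✓`B8Thm4SupportLocalPer.thm4_exists_step_onBonds_supp_explicit` called at the EMPTY restriction family, where its own (1.29) letter
is vacuous — `restr129_empty` — the abstract letter `R (m+1) (u₁·v)` being carried next to it).  Kind «kernel-checked proof», theorems only: no `def`, no `… : Prop` fact,
no `instance`, no `notation`, no existing module modified.  `--supports stmt-QuantumFields-20541 --as helper` (K0⁷-keyed, COUNT-NEUTRAL; N05-REC stage 2).

## WHAT IS CERTIFIED HERE (kernel; axioms `propext` ∕ `Classical.choice` ∕ `Quot.sound`)
* §1 `restr129_empty` — (1.29) on the empty family of restriction sets is vacuous (the pass-through letter of the landed step).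
* §1 ★★ `thm4_exists_all_levels_supp_bdry_mem_R129` — THE DRIVER with (1.29) abstract: sockets `hP5base`∕`hP5` ask for ∕ deliver a `G`-valued `v` with `v = 1` off `S`
  AND `R 1 (1·v)` ∕ `R (m+1) (u₁·v)`; the Proposition-3 reset `hP3` reads `R m u`; conclusion at every `m ≤ k`: a `G`-VALUED `u` with `u = 1` off `S`, `R m u`,
  `W = U′^{u⁻¹}` in the gauge `Lan m`, its exponent in the (1.69)∕`c⋆` shape on `E_j`, `j ≤ m`.
* §2 `example` — CONSISTENCY CERTIFICATE: the statement of ✓`B8Thm4SupportLocalBdryG.thm4_exists_all_levels_supp_bdry_mem` follows from §1 at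
  `R m u := Restr129 L m (Λs m) U₀ u`, `R 0 1 := restr129_one` (one `exact`; not a new declaration).

HONEST SCOPE: bookkeeping over landed theorems; Propositions 3 ∕ 5 are NOT proved (sockets displayed); the composition with the edition-γ in-edge
(`B8Thm4KLevelGamma.hP3_gaugeFixed_of_b9_γ`, (1.42), (1.56)) is NOT abstracted here (it READS the averaging; record twin = N05-REC R5 sub-chain β∕α-§2, later);
`HThm4Rec` UNDISCHARGED; caveat (C-S3-1) stands; N05 [B8] DISCHARGED OF RECORD untouched; COUNT 7∕28 (7∕27 excl. NODE O) · K 1∕4 UNMOVED; one finite `𝕋⁴` programme at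
fixed `ε`, Bałaban AS PRINTED; nothing continuum ∕ ℝ⁴ ∕ OS ∕ mass-gap ∕ Clay — the Yang–Mills mass gap is NOT proved by any of this.  No `sorry`, no `def`.

RELATED, NOT DUPLICATED: `B8Thm4SupportLocalBdryG` (§1 = the `R := Restr129` instance, §2 re-derives its statement), `B8Thm4SupportLocalBdry` ∕ `B8Thm4SupportLocal` ∕
`B8Thm4SupportLocalPer` ∕ `B8Thm4InductionLocal(G)` (earlier editions of the same induction; the step is USED by name), `B8Thm4TruncationLocal.base_datum ∕ restr129_one` (USED).

[cite: Balaban1985RegularSpaces, Thm 4 p.88, proof pp.88–89 + 94–95 ((1.107)–(1.111)), Prop. 5 p.94, Prop. 3 p.87, (1.17) p.78, (1.29) p.81, p.76; Balaban1987RG1, (0.4) p.253, pp.253–254]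
-/

noncomputable section

open NormedSpace

namespace Literature.MathematicalPhysics.QuantumFieldTheory.Balaban1983to89.B8Thm4SupportLocalBdryGR129

open Complex (I)
open MatrixLog B7Prop1Explicit B7Prop2Explicit B7Prop1Local B7Eq92Concrete
open B8Ineq132 (covDerivFwd)
open B8Eq119TwistedAxial (Restr129)
open B8Eq184Proof (gaugeExp cfgExp)
open B8Thm4SupportLocalPer (thm4_exists_step_onBonds_supp_explicit)
open B8Thm4TruncationLocal (base_datum restr129_one)

-- `Site` alone could resolve to the torus sites of `Setup.lean`; re-export the `ℤ^d` sites of `B7Prop1Explicit`.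
export B7Prop1Explicit (Site)

variable {d : ℕ}

/-! ## §1 The driver with the support invariant, the gauge-group invariant, and the restriction (1.29) as an abstract letter -/

section Main

variable {𝔸 : Type*} [CStarAlgebra 𝔸] [Nontrivial 𝔸]
variable {L k : ℕ} {η : ℝ} {U₀ U' : Site d → Fin d → 𝔸ˣ} {a cstar α₄ : ℝ}

omit [Nontrivial 𝔸] in
/-- (1.29) relative to the EMPTY family of restriction sets `Λ_j = ∅` holds for every `u` (there is no `y ∈ Λ_j` to restrict) — the vacuous instance at
which the landed induction step is called, its (1.29) letter being pass-through. [cite: Balaban1985RegularSpaces, (1.29) p.81] -/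
theorem restr129_empty (L k : ℕ) (U₀ : Site d → Fin d → 𝔸ˣ) (u : Site d → 𝔸ˣ) :
    Restr129 L k (fun _ => (∅ : Set (Site d))) U₀ u :=
  fun _ _ y hy => absurd hy (Set.notMem_empty y)

/-- One level up costs a factor `L` ((1.111) bookkeeping; as in `B8Thm4SupportLocalBdryG`). [cite: Balaban1985RegularSpaces, (1.111) p.95] -/
private theorem level_shift (hL1 : 1 ≤ L) (hη : 0 < η) (hc : 0 ≤ cstar) (j : ℕ) :
    cstar * ((L : ℝ) ^ j * η)⁻¹ = L * cstar * ((L : ℝ) ^ (j + 1) * η)⁻¹ ∧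
      cstar * ((L : ℝ) ^ j * η)⁻¹ ≤ L * cstar * ((L : ℝ) ^ j * η)⁻¹ := by
  have hLr : (1 : ℝ) ≤ L := by exact_mod_cast hL1
  have hL0 : (0 : ℝ) < L := by linarith
  have ht : 0 ≤ ((L : ℝ) ^ j * η)⁻¹ := by positivity
  refine ⟨?_, ?_⟩
  · rw [pow_succ]
    field_simp
  · calc cstar * ((L : ℝ) ^ j * η)⁻¹ = 1 * cstar * ((L : ℝ) ^ j * η)⁻¹ := by ring
      _ ≤ L * cstar * ((L : ℝ) ^ j * η)⁻¹ := by gcongr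

/-- ★★ **THEOREM 4's LEVEL INDUCTION WITH THE SUPPORT INVARIANT, THE GAUGE-GROUP INVARIANT, AND THE RESTRICTION (1.29) AS AN ABSTRACT LETTER** —
✓`B8Thm4SupportLocalBdryG.thm4_exists_all_levels_supp_bdry_mem` re-run with «`u` satisfies (1.29) at `m` levels» an ABSTRACT predicate `R m u` in place of
`Restr129 L m (Λs m) U₀ u`: the Proposition-5 sockets `hP5base` ∕ `hP5` are asked at a `G`-valued level datum `u₁` with `u₁ = 1` off `S` (and `R m u₁`) and
DELIVER a `G`-valued `v` with `v = 1` off `S` together with `R 1 (1·v)` ∕ `R (m+1) (u₁·v)`, the Proposition-3 reset `hP3` reads `R m u` and the support clause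
(unitary `u`), and the induction produces at every `m ≤ k` a `G`-VALUED `u` with `u = 1` off `S` and `R m u` (`u₀ = 1` by `hR0 : R 0 1`, `u_{m+1} = u_m·v`,
closure of `G`, `1·1 = 1`) with `W = U′^{u⁻¹}` in the gauge `Lan m` and its exponent in the (1.69)∕`c⋆` shape on `E_j`, `j ≤ m` — everything else verbatim
(step = ✓`thm4_exists_step_onBonds_supp_explicit` at the empty restriction family, base datum `A₀ = (1∕iη) log U′`).  Print's (1.29) with [3]'s corner tree
words is the instance `R m u := Restr129 L m (Λs m) U₀ u` (§2); the (0.4)-structure of [Balaban1987RG1] is another instance.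
[cite: Balaban1985RegularSpaces, Thm 4 p.88, proof pp.88–89 + 94–95, Prop. 5 (1.107)–(1.108) p.94, Prop. 3 p.87, (1.17) p.78, (1.29) p.81, p.76 («G = SU(N)»); Balaban1987RG1, pp.253–254] -/
theorem thm4_exists_all_levels_supp_bdry_mem_R129 (hL1 : 1 ≤ L) (hη : 0 < η) (S : Set (Site d)) (G : Subgroup 𝔸ˣ) (hG : G ≤ unitaryUnits 𝔸)
    (hU₀ : ∀ x κ, U₀ x κ ∈ unitaryUnits 𝔸) (hU' : ∀ x κ, U' x κ ∈ unitaryUnits 𝔸)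
    (hcstar : 0 ≤ cstar) (hα₄ : 0 ≤ α₄) (hs₁ : α₄ ≤ 1 / 84) (hs₂ : L * cstar ≤ 1 / 12) (ha : a ≤ 1 / 4) (ha2 : 2 * a ≤ cstar)
    (E : ℕ → Set (Site d × Fin d)) (hE : ∀ j, E (j + 1) ⊆ E j)
    (h66 : ∀ b ∈ E 0, ‖((U' b.1 b.2 : 𝔸ˣ) : 𝔸) - 1‖ ≤ a)
    (R : ℕ → (Site d → 𝔸ˣ) → Prop) (hR0 : R 0 1) (Lan : ℕ → (Site d → Fin d → 𝔸ˣ) → Prop)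
    (hP5base : ∃ (v : Site d → 𝔸ˣ) (lam : Site d → 𝔸), (∀ x, v x ∈ G) ∧ (∀ x, x ∉ S → v x = 1) ∧
        (∀ j, j ≤ 1 → ∀ b ∈ E j, (v b.1 : 𝔸) = ((gaugeExp lam b.1 : 𝔸ˣ) : 𝔸) ∧
          (v (b.1 + e b.2) : 𝔸) = ((gaugeExp lam (b.1 + e b.2) : 𝔸ˣ) : 𝔸)) ∧
        (∀ j, j ≤ 1 → ∀ b ∈ E j, ‖lam b.1‖ ≤ α₄ ∧ ((L : ℝ) ^ j * η) * ‖covDerivFwd η U₀ b.2 lam b.1‖ ≤ α₄) ∧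
        Lan 1 (mgauge U₀ v⁻¹ U') ∧ R 1 ((1 : Site d → 𝔸ˣ) * v))
    (hP5 : ∀ m, 1 ≤ m → m < k → ∀ (u₁ : Site d → 𝔸ˣ) (U₁ : Site d → Fin d → 𝔸ˣ) (A : Site d → Fin d → 𝔸),
      (∀ x, u₁ x ∈ G) → (∀ x, x ∉ S → u₁ x = 1) → mgauge U₀ u₁ U₁ = U' → R m u₁ → Lan m U₁ →
      (∀ j, j ≤ m → ∀ b ∈ E j, U₁ b.1 b.2 = cfgExp η A b.1 b.2 ∧ IsSelfAdjoint (A b.1 b.2) ∧ ‖A b.1 b.2‖ ≤ cstar * ((L : ℝ) ^ j * η)⁻¹) →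
      ∃ (v : Site d → 𝔸ˣ) (lam : Site d → 𝔸), (∀ x, v x ∈ G) ∧ (∀ x, x ∉ S → v x = 1) ∧
        (∀ j, j ≤ m + 1 → ∀ b ∈ E j, (v b.1 : 𝔸) = ((gaugeExp lam b.1 : 𝔸ˣ) : 𝔸) ∧
          (v (b.1 + e b.2) : 𝔸) = ((gaugeExp lam (b.1 + e b.2) : 𝔸ˣ) : 𝔸)) ∧
        (∀ j, j ≤ m + 1 → ∀ b ∈ E j, ‖lam b.1‖ ≤ α₄ ∧ ((L : ℝ) ^ j * η) * ‖covDerivFwd η U₀ b.2 lam b.1‖ ≤ α₄) ∧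
        Lan (m + 1) (mgauge U₀ v⁻¹ U₁) ∧ R (m + 1) (u₁ * v))
    (hP3 : ∀ m, 1 ≤ m → m ≤ k → ∀ (u : Site d → 𝔸ˣ) (W : Site d → Fin d → 𝔸ˣ) (A : Site d → Fin d → 𝔸),
      (∀ x, u x ∈ unitaryUnits 𝔸) → (∀ x, x ∉ S → u x = 1) → mgauge U₀ u W = U' → R m u → Lan m W →
      (∀ j, j ≤ m → ∀ b ∈ E j, W b.1 b.2 = cfgExp η A b.1 b.2 ∧ ‖A b.1 b.2‖ ≤ (2 * (L * cstar) + 8 * α₄) * ((L : ℝ) ^ j * η)⁻¹) →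
      ∀ j, j ≤ m → ∀ b ∈ E j, ‖A b.1 b.2‖ ≤ cstar * ((L : ℝ) ^ j * η)⁻¹) :
    ∀ m, m ≤ k → ∃ u : Site d → 𝔸ˣ, (∀ x, u x ∈ G) ∧ (∀ x, x ∉ S → u x = 1) ∧ R m u ∧
      ∃ W : Site d → Fin d → 𝔸ˣ, mgauge U₀ u W = U' ∧ (1 ≤ m → Lan m W) ∧
        ∃ A : Site d → Fin d → 𝔸, ∀ j, j ≤ m → ∀ b ∈ E j,
          W b.1 b.2 = cfgExp η A b.1 b.2 ∧ IsSelfAdjoint (A b.1 b.2) ∧ ‖A b.1 b.2‖ ≤ cstar * ((L : ℝ) ^ j * η)⁻¹ := by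
  have hLc : 0 ≤ L * cstar := by positivity
  -- reading a `c⋆`-bound at levels `≤ m` as an `Lc⋆`-bound at levels `≤ m + 1` (`E` antitone)
  have hshift : ∀ (m : ℕ) (A : Site d → Fin d → 𝔸),
      (∀ j, j ≤ m → ∀ b ∈ E j, ‖A b.1 b.2‖ ≤ cstar * ((L : ℝ) ^ j * η)⁻¹) →
      ∀ j, j ≤ m + 1 → ∀ b ∈ E j, ‖A b.1 b.2‖ ≤ L * cstar * ((L : ℝ) ^ j * η)⁻¹ := by
    intro m A h j hj b hb
    rcases Nat.lt_or_ge j (m + 1) with hjm | hjm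
    · exact (h j (by omega) b hb).trans (level_shift hL1 hη hcstar j).2
    · obtain rfl : j = m + 1 := le_antisymm hj hjm
      have h' := h m le_rfl b (hE m hb)
      rw [(level_shift hL1 hη hcstar m).1] at h'
      exact h'
  -- THE COMMON TAIL OF A STEP: level-`m` datum + Proposition 5's data at level `m + 1` ⇒ the conclusion at level `m + 1`
  -- (`thm4_exists_step_onBonds_supp_explicit` with `c := Lc⋆` at the EMPTY restriction family — its (1.29) letter is pass-through, the abstract
  -- letter `R (m + 1) (u₁·v)` is carried next to it — then the reset `hP3 (m + 1)`)
  have tail : ∀ m, m < k → ∀ (u₁ : Site d → 𝔸ˣ) (U₁ : Site d → Fin d → 𝔸ˣ) (A : Site d → Fin d → 𝔸),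
      (∀ x, u₁ x ∈ G) → (∀ x, x ∉ S → u₁ x = 1) → mgauge U₀ u₁ U₁ = U' →
      (∀ j, j ≤ m → ∀ b ∈ E j, U₁ b.1 b.2 = cfgExp η A b.1 b.2 ∧ IsSelfAdjoint (A b.1 b.2) ∧
        ‖A b.1 b.2‖ ≤ cstar * ((L : ℝ) ^ j * η)⁻¹) →
      ∀ (v : Site d → 𝔸ˣ) (lam : Site d → 𝔸), (∀ x, v x ∈ G) → (∀ x, x ∉ S → v x = 1) →
        (∀ j, j ≤ m + 1 → ∀ b ∈ E j, (v b.1 : 𝔸) = ((gaugeExp lam b.1 : 𝔸ˣ) : 𝔸) ∧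
          (v (b.1 + e b.2) : 𝔸) = ((gaugeExp lam (b.1 + e b.2) : 𝔸ˣ) : 𝔸)) →
        (∀ j, j ≤ m + 1 → ∀ b ∈ E j, ‖lam b.1‖ ≤ α₄ ∧ ((L : ℝ) ^ j * η) * ‖covDerivFwd η U₀ b.2 lam b.1‖ ≤ α₄) →
        Lan (m + 1) (mgauge U₀ v⁻¹ U₁) → R (m + 1) (u₁ * v) →
      ∃ u : Site d → 𝔸ˣ, (∀ x, u x ∈ G) ∧ (∀ x, x ∉ S → u x = 1) ∧ R (m + 1) u ∧
        ∃ W : Site d → Fin d → 𝔸ˣ, mgauge U₀ u W = U' ∧ (1 ≤ m + 1 → Lan (m + 1) W) ∧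
          ∃ A' : Site d → Fin d → 𝔸, ∀ j, j ≤ m + 1 → ∀ b ∈ E j,
            W b.1 b.2 = cfgExp η A' b.1 b.2 ∧ IsSelfAdjoint (A' b.1 b.2) ∧ ‖A' b.1 b.2‖ ≤ cstar * ((L : ℝ) ^ j * η)⁻¹ := by
    intro m hmk u₁ U₁ A hu₁ hu₁S hU₁ hA v lam hv hvS hvlam h108 hLan hR
    -- `U₁ = e^{iηA}` and (1.69) with `c = Lc⋆` on `E j`, `j ≤ m + 1`
    have hAexp : ∀ j, j ≤ m + 1 → ∀ b ∈ E j, U₁ b.1 b.2 = cfgExp η A b.1 b.2 := by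
      intro j hj b hb
      rcases Nat.lt_or_ge j (m + 1) with hjm | hjm
      · exact (hA j (by omega) b hb).1
      · obtain rfl : j = m + 1 := le_antisymm hj hjm
        exact (hA m le_rfl b (hE m hb)).1
    have h69 := hshift m A (fun j hj b hb => (hA j hj b hb).2.2)
    -- the step with the new gauge transformation EXPOSED as `u₁·v` (its own (1.29) letter vacuous at the empty family)
    obtain ⟨-, huS, -, hW, hLanW, hA'⟩ := thm4_exists_step_onBonds_supp_explicit (k := m + 1) (Λ := fun _ => (∅ : Set (Site d)))
      hL1 hη hU₀ hU' (fun x => hG (hu₁ x)) (fun x => hG (hv x)) S hu₁S hvS hLc hα₄ hs₁ hs₂ hU₁ E hAexp h69 hvlam h108 (Lan (m + 1)) hLan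
      (restr129_empty L (m + 1) U₀ (u₁ * v))
    have hu : ∀ x, (u₁ * v) x ∈ G := fun x => by rw [Pi.mul_apply]; exact G.mul_mem (hu₁ x) (hv x)
    -- Proposition 3 at level `m + 1`: reset the constant `2Lc⋆ + 8α₄ ↦ c⋆` (the socket reads the support clause and the abstract letter)
    have hreset := hP3 (m + 1) (by omega) (by omega) (u₁ * v) _ _ (fun x => hG (hu x)) huS hW hR hLanW
      (fun j hj b hb => ⟨(hA' j hj b hb).1, (hA' j hj b hb).2.2⟩)
    exact ⟨u₁ * v, hu, huS, hR, _, hW, fun _ => hLanW, _, fun j hj b hb => ⟨(hA' j hj b hb).1, (hA' j hj b hb).2.1, hreset j hj b hb⟩⟩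
  -- THE BASE DATUM: `u = 1`, `W = U′`, `A₀ = (1/iη) log U′`
  have base : ∀ j, j ≤ 0 → ∀ b ∈ E j,
      U' b.1 b.2 = cfgExp η (fun y μ => η⁻¹ • ((I⁻¹ : ℂ) • mlog ((U' y μ : 𝔸ˣ) : 𝔸))) b.1 b.2 ∧
        IsSelfAdjoint ((fun y μ => η⁻¹ • ((I⁻¹ : ℂ) • mlog ((U' y μ : 𝔸ˣ) : 𝔸))) b.1 b.2) ∧
        ‖(fun y μ => η⁻¹ • ((I⁻¹ : ℂ) • mlog ((U' y μ : 𝔸ˣ) : 𝔸))) b.1 b.2‖ ≤ cstar * ((L : ℝ) ^ j * η)⁻¹ := by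
    intro j hj b hb
    obtain rfl : j = 0 := Nat.le_zero.mp hj
    obtain ⟨-, hexp, hsa, hbd⟩ := base_datum hη U₀ U' hU' ha b.1 b.2 (h66 b hb)
    refine ⟨hexp, hsa, hbd.trans ?_⟩
    rw [pow_zero, one_mul]
    exact mul_le_mul_of_nonneg_right ha2 (inv_nonneg.mpr hη.le)
  have hone : mgauge U₀ (1 : Site d → 𝔸ˣ) U' = U' := by
    funext z μ; simp [mgauge_apply]
  intro m
  induction m with
  | zero =>
    intro _
    exact ⟨1, fun _ => G.one_mem, fun _ _ => rfl, hR0, U', hone, fun h => absurd h (by omega), _, base⟩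
  | succ m ih =>
    intro hmk
    rcases Nat.eq_zero_or_pos m with rfl | hm
    · -- the first step («k = 1»): Proposition 5 for the base datum
      obtain ⟨v, lam, hv, hvS, hvlam, h108, hLan, hR⟩ := hP5base
      exact tail 0 (by omega) 1 U' _ (fun _ => G.one_mem) (fun _ _ => rfl) hone base v lam hv hvS hvlam h108 hLan hR
    · -- the general step: Proposition 5 for the datum delivered at level `m`
      obtain ⟨u₁, hu₁, hu₁S, hR₁, U₁, hU₁, hLan₁, A, hA⟩ := ih (by omega)
      obtain ⟨v, lam, hv, hvS, hvlam, h108, hLan, hR⟩ := hP5 m hm (by omega) u₁ U₁ A hu₁ hu₁S hU₁ hR₁ (hLan₁ hm) hA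
      exact tail m (by omega) u₁ U₁ A hu₁ hu₁S hU₁ hA v lam hv hvS hvlam h108 hLan hR

end Main

/-! ## §2 Consistency certificate: print's (1.29) with [3]'s corner tree words is the instance `R m u := Restr129 L m (Λs m) U₀ u` -/

section Certificate

variable {𝔸 : Type*} [CStarAlgebra 𝔸] [Nontrivial 𝔸]
variable {L k : ℕ} {η : ℝ} {U₀ U' : Site d → Fin d → 𝔸ˣ} {a cstar α₄ : ℝ}

-- ✓`B8Thm4SupportLocalBdryG.thm4_exists_all_levels_supp_bdry_mem`'s statement, re-derived from §1 by ONE `exact` (kernel-checked; no new declaration).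
example (hL1 : 1 ≤ L) (hη : 0 < η) (S : Set (Site d)) (G : Subgroup 𝔸ˣ) (hG : G ≤ unitaryUnits 𝔸)
    (hU₀ : ∀ x κ, U₀ x κ ∈ unitaryUnits 𝔸) (hU' : ∀ x κ, U' x κ ∈ unitaryUnits 𝔸)
    (hcstar : 0 ≤ cstar) (hα₄ : 0 ≤ α₄) (hs₁ : α₄ ≤ 1 / 84) (hs₂ : L * cstar ≤ 1 / 12) (ha : a ≤ 1 / 4) (ha2 : 2 * a ≤ cstar)
    (E : ℕ → Set (Site d × Fin d)) (hE : ∀ j, E (j + 1) ⊆ E j)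
    (h66 : ∀ b ∈ E 0, ‖((U' b.1 b.2 : 𝔸ˣ) : 𝔸) - 1‖ ≤ a)
    (Λs : ℕ → ℕ → Set (Site d)) (Lan : ℕ → (Site d → Fin d → 𝔸ˣ) → Prop)
    (hP5base : ∃ (v : Site d → 𝔸ˣ) (lam : Site d → 𝔸), (∀ x, v x ∈ G) ∧ (∀ x, x ∉ S → v x = 1) ∧
        (∀ j, j ≤ 1 → ∀ b ∈ E j, (v b.1 : 𝔸) = ((gaugeExp lam b.1 : 𝔸ˣ) : 𝔸) ∧
          (v (b.1 + e b.2) : 𝔸) = ((gaugeExp lam (b.1 + e b.2) : 𝔸ˣ) : 𝔸)) ∧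
        (∀ j, j ≤ 1 → ∀ b ∈ E j, ‖lam b.1‖ ≤ α₄ ∧ ((L : ℝ) ^ j * η) * ‖covDerivFwd η U₀ b.2 lam b.1‖ ≤ α₄) ∧
        Lan 1 (mgauge U₀ v⁻¹ U') ∧ Restr129 L 1 (Λs 1) U₀ ((1 : Site d → 𝔸ˣ) * v))
    (hP5 : ∀ m, 1 ≤ m → m < k → ∀ (u₁ : Site d → 𝔸ˣ) (U₁ : Site d → Fin d → 𝔸ˣ) (A : Site d → Fin d → 𝔸),
      (∀ x, u₁ x ∈ G) → (∀ x, x ∉ S → u₁ x = 1) → mgauge U₀ u₁ U₁ = U' → Restr129 L m (Λs m) U₀ u₁ → Lan m U₁ →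
      (∀ j, j ≤ m → ∀ b ∈ E j, U₁ b.1 b.2 = cfgExp η A b.1 b.2 ∧ IsSelfAdjoint (A b.1 b.2) ∧ ‖A b.1 b.2‖ ≤ cstar * ((L : ℝ) ^ j * η)⁻¹) →
      ∃ (v : Site d → 𝔸ˣ) (lam : Site d → 𝔸), (∀ x, v x ∈ G) ∧ (∀ x, x ∉ S → v x = 1) ∧
        (∀ j, j ≤ m + 1 → ∀ b ∈ E j, (v b.1 : 𝔸) = ((gaugeExp lam b.1 : 𝔸ˣ) : 𝔸) ∧
          (v (b.1 + e b.2) : 𝔸) = ((gaugeExp lam (b.1 + e b.2) : 𝔸ˣ) : 𝔸)) ∧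
        (∀ j, j ≤ m + 1 → ∀ b ∈ E j, ‖lam b.1‖ ≤ α₄ ∧ ((L : ℝ) ^ j * η) * ‖covDerivFwd η U₀ b.2 lam b.1‖ ≤ α₄) ∧
        Lan (m + 1) (mgauge U₀ v⁻¹ U₁) ∧ Restr129 L (m + 1) (Λs (m + 1)) U₀ (u₁ * v))
    (hP3 : ∀ m, 1 ≤ m → m ≤ k → ∀ (u : Site d → 𝔸ˣ) (W : Site d → Fin d → 𝔸ˣ) (A : Site d → Fin d → 𝔸),
      (∀ x, u x ∈ unitaryUnits 𝔸) → (∀ x, x ∉ S → u x = 1) → mgauge U₀ u W = U' → Restr129 L m (Λs m) U₀ u → Lan m W →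
      (∀ j, j ≤ m → ∀ b ∈ E j, W b.1 b.2 = cfgExp η A b.1 b.2 ∧ ‖A b.1 b.2‖ ≤ (2 * (L * cstar) + 8 * α₄) * ((L : ℝ) ^ j * η)⁻¹) →
      ∀ j, j ≤ m → ∀ b ∈ E j, ‖A b.1 b.2‖ ≤ cstar * ((L : ℝ) ^ j * η)⁻¹) :
    ∀ m, m ≤ k → ∃ u : Site d → 𝔸ˣ, (∀ x, u x ∈ G) ∧ (∀ x, x ∉ S → u x = 1) ∧ Restr129 L m (Λs m) U₀ u ∧
      ∃ W : Site d → Fin d → 𝔸ˣ, mgauge U₀ u W = U' ∧ (1 ≤ m → Lan m W) ∧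
        ∃ A : Site d → Fin d → 𝔸, ∀ j, j ≤ m → ∀ b ∈ E j,
          W b.1 b.2 = cfgExp η A b.1 b.2 ∧ IsSelfAdjoint (A b.1 b.2) ∧ ‖A b.1 b.2‖ ≤ cstar * ((L : ℝ) ^ j * η)⁻¹ :=
  thm4_exists_all_levels_supp_bdry_mem_R129 hL1 hη S G hG hU₀ hU' hcstar hα₄ hs₁ hs₂ ha ha2 E hE h66
    (fun m u => Restr129 L m (Λs m) U₀ u) (restr129_one L 0 (Λs 0) U₀) Lan hP5base hP5 hP3

end Certificate

end Literature.MathematicalPhysics.QuantumFieldTheory.Balaban1983to89.B8Thm4SupportLocalBdryGR129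

end
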